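import Literature.NumberTheory.Automorphic.UnitarySimilitudeFixedPointSumTransport   -- ★ B-p10 (g26) (H4) FILE 1: `exists_continuousMulEquiv_modular`, `finsum_fixedBy_quotient_mapConj_eq`, parity flip, rider
import Literature.NumberTheory.Rogawski1990.RankOneKappaOrbitalDepthExpansion          -- ★ A-p13 (g31) (α) LAYER 2-B (H3): `finsum_fixedBy_conj_eq_depthExpansion_at`
import Literature.NumberTheory.Rogawski1990.LocalStableClassesNonsplit                 -- ★ A-p13: `twistGram_eigenframe_apply_ne_zero`
import HarnessLib

/-!
# (α) LAYER 2-B′ = (H4): THE DEPTH EXPANSION of `Σ_{q ∈ Fix_γ(U⧸K¹)} φ(q.out⁻¹ γ q.out)` AT THE SECOND VERTEX TYPE (`K¹ = U ∩ D_ϖ GL₂(𝒪_w) D_ϖ⁻¹`, the `ϖ`-modular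
# vertex stabiliser) — the TRANSPORT of ★ A-p13 (H3) along the similitude `D_ϖ = diag(1, ϖ_w)`; the PARITY BIT FLIPS (`↔ e = 1`) and the value points are `Ad(D_ϖ)` of (H3)'s
(Rogawski 1990 §4.9 Lemma 4.9.3, §12.6 p. 174; Labesse–Langlands 1979 §2; Kottwitz 1988 §2 — road «R1LL-tree», architect A-p16 (g27) RULING A-14 (b), hand B-p10 (g26))

Topic `NumberTheory/Rogawski1990`; namespace `Literature.NumberTheory.Automorphic.UnitaryGroup` (that of ★ (H3)).  THEOREMS ONLY (no definition, no instance, no notation, no named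
fact, no `sorry`).  Cell `pub/hodgecm-mathlib` (D-0151), crux H413 = `stmt-HodgeConjecture-24833`, line «N6nsGerm», stub `stub_N6nsR1LL` (#159).  HONEST LABEL: HC_CM is proved only
modulo the printed citations (the 2 remaining named inputs hLiu418, h413) until rung 0 closes; nothing printed is asserted here.

THE STATEMENT = ★ `finsum_fixedBy_conj_eq_depthExpansion_at` with `K⁰ ↦ K¹ := ((glInt 2 L_w).map (MulAut.conj D_ϖ)).subgroupOf U`,
`D_ϖ := glDiagonal 2 L_w ![1, Units.mk0 ϖ_w _]` (★ A-p16 `exists_vertexCover`'s spelling of `K₂ 1`), the level-`m` subgroup `Km ≤ U` now DATA with the membership hypothesis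
read through `Ad(D_ϖ⁻¹)` (`(∀ r s, ϖ_w^{−m}(↑(D_ϖ⁻¹ y D_ϖ) − 1) r s ∈ 𝒪) → y ∈ Km`), `φ : U → E` invariant under `Ad K¹` and right-`Km`:
**`finsum_fixedBy_conj_eq_depthExpansion_modular_at`** — `∃ e ≤ 1, (Even (log v ⟨p₀,p₀⟩) ↔ e = 1) ∧ ∃ xm x, ↑xm = u₁ • 1 ∧ (∀ i, ↑(x i) = u₁ • (1 + (ϖ_w^i·ϖ_w⁻¹) • N_δ)) ∧
Σᶠ_{q ∈ Fix_γ(U⧸K¹)} φ(q.out⁻¹ γ q.out) = (Σ_{j ∈ range (n+1), j % 2 = e ∧ j + m ≤ n} w_j) • φ xm + Σ_{i < m} [i ≤ n ∧ (n − i) % 2 = e]·w_{n−i} • φ (x i)` — the SAME sums as (H3)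
with the OPPOSITE parity characterisation.  PROOF (A-14 (b)): `e_ϖ := Ad(D_ϖ⁻¹) : U ≃ₜ* U` (★ FILE 1 `exists_continuousMulEquiv_modular`) carries `K¹ ↦ K⁰`, so ★ FILE 1
`finsum_fixedBy_quotient_mapConj_eq` rewrites the `K¹`-sum as the `K⁰`-sum of `φ ∘ e_ϖ.symm` at `e_ϖ γ = D_ϖ⁻¹γD_ϖ` (eigenframe `D_ϖ⁻¹P`, SAME eigenvalues `u`, ★ FILE 1
`coe_conj_mul_eq_mul_diagonal`); ★ (H3) evaluates it; the frame invariant `⟨p₀′, p₀′⟩ = ϖ_w⁻¹⟨p₀, p₀⟩` (★ FILE 1 `twistGram_coe_inv_mul_apply`) has the OPPOSITE log-parity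
(`log|ϖ_w| = −1` at an unramified `w`, ★ FILE 1 `even_log_inv_mul_iff_not_even`; `⟨p₀,p₀⟩ ≠ 0` by ★ `twistGram_eigenframe_apply_ne_zero`), and the value points are
`e_ϖ.symm` of (H3)'s, i.e. `D_ϖ·u₁(1 + ϖ^i N_δ)·D_ϖ⁻¹ = u₁(1 + ϖ^iϖ⁻¹ N_δ)` (★ FILE 1 rider).  Consumer: F0P3-p01 (g13) (β) ED. 3 `hD`, vertex type `ε = 1` (A-15 (c)).

## References
* [Rogawski1990] J. D. Rogawski, *Automorphic Representations of Unitary Groups in Three Variables* (1990), §4.9 Lemma 4.9.3 p. 56; §12.6 p. 174.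
* [LabesseLanglands1979] J.-P. Labesse, R. P. Langlands, *L-indistinguishability for SL(2)*, Canad. J. Math. 31 (1979), §2.
* [Kottwitz1988] R. E. Kottwitz, *Tamagawa numbers*, Ann. of Math. 127 (1988), §2.
-/

set_option autoImplicit false

noncomputable section

open NumberField IsDedekindDomain Matrix Finset ValuativeRel MulAction
open scoped ValuativeRel Matrix MatrixGroups

namespace Literature.NumberTheory.Automorphic.UnitaryGroup

open Literature.NumberTheory.Rogawski1990 Literature.NumberTheory.GaloisRepresentations

variable (L : Type) [Field L] [NumberField L] [IsCMField L] (v : HeightOneSpectrum (𝓞 ↥(maximalRealSubfield L)))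
  (w : PlacesOver L v) (hw : IsCMField.complexConj L • w.1 = w.1)

-- the `L_w`-sized statement costs several times the default ELABORATION budget (no search, no `decide`), as for ★ (H3)
set_option maxHeartbeats 1600000 in
include hw in
/-- **(α) LAYER 2-B′ (H4): THE DEPTH EXPANSION OF THE FIXED-POINT SUM AT THE `ϖ`-MODULAR VERTEX TYPE `K¹`.**  See the module docstring: ★ (H3) transported along
`Ad(D_ϖ⁻¹)`, `D_ϖ = diag(1, ϖ_w)`; parity characterisation `↔ e = 1`; value points `u₁ • 1` and `u₁ • (1 + (ϖ_w^i ϖ_w⁻¹) • [[0, δ],[0, 0]])`, `δ = σO a₀ − a₀`.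
[cite: Rogawski1990, §4.9 Lemma 4.9.3 p. 56; §12.6 p. 174] [cite: LabesseLanglands1979, §2] [cite: Kottwitz1988, §2] -/
theorem finsum_fixedBy_conj_eq_depthExpansion_modular_at (hunr : Algebra.IsUnramifiedIn (𝓞 L) v.asIdeal)
    (σO : 𝒪[w.1.adicCompletion L] →+* 𝒪[w.1.adicCompletion L])
    (hσO' : ∀ x : 𝒪[w.1.adicCompletion L], ((σO x : 𝒪[w.1.adicCompletion L]) : w.1.adicCompletion L) = galAdicCompletionMap (L := L) (IsCMField.complexConj L) hw x)
    (hσσ : ∀ x, σO (σO x) = x) {a₀ : 𝒪[w.1.adicCompletion L]} (ha₀ : IsUnit (σO a₀ - a₀))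
    {γ : ↥(unitaryGroupOfForm (galAdicCompletionMap (L := L) (IsCMField.complexConj L) hw) (placeForm (Matrix.of fun i j : Fin 2 => if i.val + j.val + 1 = 2 then (1 : L) else 0) w.1))} {P : GL (Fin 2) (w.1.adicCompletion L)} {u : Fin 2 → w.1.adicCompletion L}
    (hP : (((γ : ↥(unitaryGroupOfForm (galAdicCompletionMap (L := L) (IsCMField.complexConj L) hw) (placeForm (Matrix.of fun i j : Fin 2 => if i.val + j.val + 1 = 2 then (1 : L) else 0) w.1))) : GL (Fin 2) (w.1.adicCompletion L)) : Matrix (Fin 2) (Fin 2) (w.1.adicCompletion L)) * P = P * diagonal u) (hu : Function.Injective u)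
    (hu1 : ∀ i, galAdicCompletionMap (L := L) (IsCMField.complexConj L) hw (u i) * u i = 1) {n : ℕ}
    (hn : Valued.v (u 0 - u 1) = Valued.v (toPlace v w (HeckeCharacter.uniformizer ↥(maximalRealSubfield L) v : v.adicCompletion ↥(maximalRealSubfield L))) ^ n)
    {m : ℕ} (hmn : m ≤ n) (Km : Subgroup ↥(unitaryGroupOfForm (galAdicCompletionMap (L := L) (IsCMField.complexConj L) hw) (placeForm (Matrix.of fun i j : Fin 2 => if i.val + j.val + 1 = 2 then (1 : L) else 0) w.1)))
    (hKm : ∀ y : ↥(unitaryGroupOfForm (galAdicCompletionMap (L := L) (IsCMField.complexConj L) hw) (placeForm (Matrix.of fun i j : Fin 2 => if i.val + j.val + 1 = 2 then (1 : L) else 0) w.1)),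
      (∀ r s, toPlace v w (HeckeCharacter.uniformizer ↥(maximalRealSubfield L) v : v.adicCompletion ↥(maximalRealSubfield L)) ^ (-(m : ℤ)) *
        ((((glDiagonal 2 (w.1.adicCompletion L) ![1, Units.mk0 (toPlace v w (HeckeCharacter.uniformizer ↥(maximalRealSubfield L) v : v.adicCompletion ↥(maximalRealSubfield L))) (toPlace_uniformizer_ne_zero L v w hunr)])⁻¹ * ((y : ↥(unitaryGroupOfForm (galAdicCompletionMap (L := L) (IsCMField.complexConj L) hw) (placeForm (Matrix.of fun i j : Fin 2 => if i.val + j.val + 1 = 2 then (1 : L) else 0) w.1))) : GL (Fin 2) (w.1.adicCompletion L)) * glDiagonal 2 (w.1.adicCompletion L) ![1, Units.mk0 (toPlace v w (HeckeCharacter.uniformizer ↥(maximalRealSubfield L) v : v.adicCompletion ↥(maximalRealSubfield L))) (toPlace_uniformizer_ne_zero L v w hunr)] : GL (Fin 2) (w.1.adicCompletion L)) : Matrix (Fin 2) (Fin 2) (w.1.adicCompletion L)) - 1) r s ∈ 𝒪[w.1.adicCompletion L]) → y ∈ Km)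
    {E : Type*} [AddCommMonoid E] (φ : ↥(unitaryGroupOfForm (galAdicCompletionMap (L := L) (IsCMField.complexConj L) hw) (placeForm (Matrix.of fun i j : Fin 2 => if i.val + j.val + 1 = 2 then (1 : L) else 0) w.1)) → E)
    (hφAd : ∀ k ∈ ((glInt 2 (w.1.adicCompletion L)).map (MulAut.conj (glDiagonal 2 (w.1.adicCompletion L) ![1, Units.mk0 (toPlace v w (HeckeCharacter.uniformizer ↥(maximalRealSubfield L) v : v.adicCompletion ↥(maximalRealSubfield L))) (toPlace_uniformizer_ne_zero L v w hunr)])).toMonoidHom).subgroupOf (unitaryGroupOfForm (galAdicCompletionMap (L := L) (IsCMField.complexConj L) hw) (placeForm (Matrix.of fun i j : Fin 2 => if i.val + j.val + 1 = 2 then (1 : L) else 0) w.1)), ∀ x, φ (k * x * k⁻¹) = φ x)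
    (hφm : ∀ x, ∀ y ∈ Km, φ (x * y) = φ x) :
    ∃ e : ℕ, e ≤ 1 ∧
      (Even (WithZero.log (Valued.v (twistGram (galAdicCompletionMap (L := L) (IsCMField.complexConj L) hw) (placeForm (Matrix.of fun i j : Fin 2 => if i.val + j.val + 1 = 2 then (1 : L) else 0) w.1) P.val 0 0))) ↔ e = 1) ∧
      ∃ (xm : ↥(unitaryGroupOfForm (galAdicCompletionMap (L := L) (IsCMField.complexConj L) hw) (placeForm (Matrix.of fun i j : Fin 2 => if i.val + j.val + 1 = 2 then (1 : L) else 0) w.1))) (x : ℕ → ↥(unitaryGroupOfForm (galAdicCompletionMap (L := L) (IsCMField.complexConj L) hw) (placeForm (Matrix.of fun i j : Fin 2 => if i.val + j.val + 1 = 2 then (1 : L) else 0) w.1))),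
        (((xm : ↥(unitaryGroupOfForm (galAdicCompletionMap (L := L) (IsCMField.complexConj L) hw) (placeForm (Matrix.of fun i j : Fin 2 => if i.val + j.val + 1 = 2 then (1 : L) else 0) w.1))) : GL (Fin 2) (w.1.adicCompletion L)) : Matrix (Fin 2) (Fin 2) (w.1.adicCompletion L)) = u 1 • (1 : Matrix (Fin 2) (Fin 2) (w.1.adicCompletion L)) ∧
        (∀ i, (((x i : ↥(unitaryGroupOfForm (galAdicCompletionMap (L := L) (IsCMField.complexConj L) hw) (placeForm (Matrix.of fun i j : Fin 2 => if i.val + j.val + 1 = 2 then (1 : L) else 0) w.1))) : GL (Fin 2) (w.1.adicCompletion L)) : Matrix (Fin 2) (Fin 2) (w.1.adicCompletion L)) =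
          u 1 • ((1 : Matrix (Fin 2) (Fin 2) (w.1.adicCompletion L)) + ((toPlace v w (HeckeCharacter.uniformizer ↥(maximalRealSubfield L) v : v.adicCompletion ↥(maximalRealSubfield L))) ^ i * (toPlace v w (HeckeCharacter.uniformizer ↥(maximalRealSubfield L) v : v.adicCompletion ↥(maximalRealSubfield L)))⁻¹) • !![0, ((σO a₀ - a₀ : 𝒪[w.1.adicCompletion L]) : w.1.adicCompletion L); 0, 0])) ∧
        ∑ᶠ q ∈ fixedBy (↥(unitaryGroupOfForm (galAdicCompletionMap (L := L) (IsCMField.complexConj L) hw) (placeForm (Matrix.of fun i j : Fin 2 => if i.val + j.val + 1 = 2 then (1 : L) else 0) w.1)) ⧸ ((glInt 2 (w.1.adicCompletion L)).map (MulAut.conj (glDiagonal 2 (w.1.adicCompletion L) ![1, Units.mk0 (toPlace v w (HeckeCharacter.uniformizer ↥(maximalRealSubfield L) v : v.adicCompletion ↥(maximalRealSubfield L))) (toPlace_uniformizer_ne_zero L v w hunr)])).toMonoidHom).subgroupOf (unitaryGroupOfForm (galAdicCompletionMap (L := L) (IsCMField.complexConj L) hw) (placeForm (Matrix.of fun i j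 : Fin 2 => if i.val + j.val + 1 = 2 then (1 : L) else 0) w.1))) γ, φ (q.out⁻¹ * γ * q.out) =
          (∑ j ∈ (range (n + 1)).filter (fun j => j % 2 = e ∧ j + m ≤ n), (if j = 0 then 1 else Nat.card (𝓞 ↥(maximalRealSubfield L) ⧸ v.asIdeal) ^ (j - 1) * (Nat.card (𝓞 ↥(maximalRealSubfield L) ⧸ v.asIdeal) + 1))) • φ xm +
          ∑ i ∈ range m, (if i ≤ n ∧ (n - i) % 2 = e then (if (n - i) = 0 then 1 else Nat.card (𝓞 ↥(maximalRealSubfield L) ⧸ v.asIdeal) ^ ((n - i) - 1) * (Nat.card (𝓞 ↥(maximalRealSubfield L) ⧸ v.asIdeal) + 1)) else 0) • φ (x i) := by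
  classical
  -- scalars at `w`
  have hϖ0 := toPlace_uniformizer_ne_zero L v w hunr
  have hϖv := Liu2021.LemD1IndexedNonVacuityInertCofinite.valued_toPlace_uniformizer_of_isUnramifiedIn L v hunr w
  have hσϖ : galAdicCompletionMap (L := L) (IsCMField.complexConj L) hw ((Units.mk0 (toPlace v w (HeckeCharacter.uniformizer ↥(maximalRealSubfield L) v : v.adicCompletion ↥(maximalRealSubfield L))) hϖ0 : (w.1.adicCompletion L)ˣ) : w.1.adicCompletion L) = (Units.mk0 (toPlace v w (HeckeCharacter.uniformizer ↥(maximalRealSubfield L) v : v.adicCompletion ↥(maximalRealSubfield L))) hϖ0 : (w.1.adicCompletion L)ˣ) := by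
    rw [Units.val_mk0]; exact galAdicCompletionMap_toPlace_self L v w hw _
  -- the similitude `D_ϖ` and `e_ϖ = Ad(D_ϖ⁻¹)`
  obtain ⟨eϖ, he, hes, hK⟩ := exists_continuousMulEquiv_modular L w hw (Units.mk0 (toPlace v w (HeckeCharacter.uniformizer ↥(maximalRealSubfield L) v : v.adicCompletion ↥(maximalRealSubfield L))) hϖ0) hσϖ
  have hD : formCongr (galAdicCompletionMap (L := L) (IsCMField.complexConj L) hw) (glDiagonal 2 (w.1.adicCompletion L) ![1, Units.mk0 (toPlace v w (HeckeCharacter.uniformizer ↥(maximalRealSubfield L) v : v.adicCompletion ↥(maximalRealSubfield L))) (toPlace_uniformizer_ne_zero L v w hunr)]) (placeForm (Matrix.of fun i j : Fin 2 => if i.val + j.val + 1 = 2 then (1 : L) else 0) w.1) = ((Units.mk0 (toPlace v w (HeckeCharacter.uniformizer ↥(maximalRealSubfield L) v : v.adicCompletion ↥(maximalRealSubfield L))) hϖ0 : (w.1.adicCompletion L)ˣ) : w.1.adicCompletion L) • placeForm (Matrix.of fun i j : Fin 2 => if i.val + j.val + 1 = 2 then (1 : L) else 0) w.1 :=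
    formCongr_glDiagonal_one_eq_smul_placeForm_antidiag L w hw _ hσϖ
  -- transported data for ★ (H3) at `eϖ γ`
  have hP' : (((eϖ γ : ↥(unitaryGroupOfForm (galAdicCompletionMap (L := L) (IsCMField.complexConj L) hw) (placeForm (Matrix.of fun i j : Fin 2 => if i.val + j.val + 1 = 2 then (1 : L) else 0) w.1))) : GL (Fin 2) (w.1.adicCompletion L)) : Matrix (Fin 2) (Fin 2) (w.1.adicCompletion L)) * ((((glDiagonal 2 (w.1.adicCompletion L) ![1, Units.mk0 (toPlace v w (HeckeCharacter.uniformizer ↥(maximalRealSubfield L) v : v.adicCompletion ↥(maximalRealSubfield L))) (toPlace_uniformizer_ne_zero L v w hunr)])⁻¹ * P : GL (Fin 2) (w.1.adicCompletion L))) : Matrix (Fin 2) (Fin 2) (w.1.adicCompletion L)) =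
      ((((glDiagonal 2 (w.1.adicCompletion L) ![1, Units.mk0 (toPlace v w (HeckeCharacter.uniformizer ↥(maximalRealSubfield L) v : v.adicCompletion ↥(maximalRealSubfield L))) (toPlace_uniformizer_ne_zero L v w hunr)])⁻¹ * P : GL (Fin 2) (w.1.adicCompletion L))) : Matrix (Fin 2) (Fin 2) (w.1.adicCompletion L)) * diagonal u := by
    rw [he]; exact coe_conj_mul_eq_mul_diagonal (D := glDiagonal 2 (w.1.adicCompletion L) ![1, Units.mk0 (toPlace v w (HeckeCharacter.uniformizer ↥(maximalRealSubfield L) v : v.adicCompletion ↥(maximalRealSubfield L))) (toPlace_uniformizer_ne_zero L v w hunr)]) (γ : GL (Fin 2) (w.1.adicCompletion L)) P hP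
  have hφAd' := conj_invariant_comp_symm eϖ (hK (glInt 2 (w.1.adicCompletion L))) φ hφAd
  have hKm' : ∀ y : ↥(unitaryGroupOfForm (galAdicCompletionMap (L := L) (IsCMField.complexConj L) hw) (placeForm (Matrix.of fun i j : Fin 2 => if i.val + j.val + 1 = 2 then (1 : L) else 0) w.1)),
      (∀ r s, toPlace v w (HeckeCharacter.uniformizer ↥(maximalRealSubfield L) v : v.adicCompletion ↥(maximalRealSubfield L)) ^ (-(m : ℤ)) * ((((y : ↥(unitaryGroupOfForm (galAdicCompletionMap (L := L) (IsCMField.complexConj L) hw) (placeForm (Matrix.of fun i j : Fin 2 => if i.val + j.val + 1 = 2 then (1 : L) else 0) w.1))) : GL (Fin 2) (w.1.adicCompletion L)) : Matrix (Fin 2) (Fin 2) (w.1.adicCompletion L)) - 1) r s ∈ 𝒪[w.1.adicCompletion L]) →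
        y ∈ Km.comap eϖ.symm.toMulEquiv.toMonoidHom := by
    intro y hy
    rw [Subgroup.mem_comap]
    change eϖ.symm y ∈ Km
    apply hKm
    intro r s
    rw [← he (eϖ.symm y), ContinuousMulEquiv.apply_symm_apply]
    exact hy r s
  have hφm' : ∀ x, ∀ y ∈ Km.comap eϖ.symm.toMulEquiv.toMonoidHom, (φ ∘ eϖ.symm) (x * y) = (φ ∘ eϖ.symm) x := by
    intro x y hy
    rw [Subgroup.mem_comap] at hy
    simp only [Function.comp_apply, map_mul]
    exact hφm _ _ hy
  obtain ⟨e, he1, hpar, xm, x, hxm, hx, hsum⟩ := finsum_fixedBy_conj_eq_depthExpansion_at L v w hw hunr σO hσO' hσσ ha₀ hP' hu hu1 hn hmn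
    (Km.comap eϖ.symm.toMulEquiv.toMonoidHom) hKm' (φ ∘ eϖ.symm) hφAd' hφm'
  refine ⟨e, he1, ?_, eϖ.symm xm, fun i => eϖ.symm (x i), ?_, ?_, ?_⟩
  · -- the parity flip: `⟨p₀′, p₀′⟩ = ϖ⁻¹ ⟨p₀, p₀⟩`, `log|ϖ| = −1` odd
    have hunit : IsUnit (((Units.mk0 (toPlace v w (HeckeCharacter.uniformizer ↥(maximalRealSubfield L) v : v.adicCompletion ↥(maximalRealSubfield L))) hϖ0 : (w.1.adicCompletion L)ˣ) : w.1.adicCompletion L)) := Units.isUnit _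
    have htw : twistGram (galAdicCompletionMap (L := L) (IsCMField.complexConj L) hw) (placeForm (Matrix.of fun i j : Fin 2 => if i.val + j.val + 1 = 2 then (1 : L) else 0) w.1) (((glDiagonal 2 (w.1.adicCompletion L) ![1, Units.mk0 (toPlace v w (HeckeCharacter.uniformizer ↥(maximalRealSubfield L) v : v.adicCompletion ↥(maximalRealSubfield L))) (toPlace_uniformizer_ne_zero L v w hunr)])⁻¹ * P : GL (Fin 2) (w.1.adicCompletion L))).val 0 0 =
        ((hunit.unit⁻¹ : (w.1.adicCompletion L)ˣ) : w.1.adicCompletion L) * twistGram (galAdicCompletionMap (L := L) (IsCMField.complexConj L) hw) (placeForm (Matrix.of fun i j : Fin 2 => if i.val + j.val + 1 = 2 then (1 : L) else 0) w.1) P.val 0 0 := by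
      rw [Units.val_mul]; exact twistGram_coe_inv_mul_apply hunit hD P.val 0 0
    have hinv : ((hunit.unit⁻¹ : (w.1.adicCompletion L)ˣ) : w.1.adicCompletion L) = (toPlace v w (HeckeCharacter.uniformizer ↥(maximalRealSubfield L) v : v.adicCompletion ↥(maximalRealSubfield L)))⁻¹ := by
      rw [Units.val_inv_eq_inv_val, IsUnit.unit_spec, Units.val_mk0]
    have hne : twistGram (galAdicCompletionMap (L := L) (IsCMField.complexConj L) hw) (placeForm (Matrix.of fun i j : Fin 2 => if i.val + j.val + 1 = 2 then (1 : L) else 0) w.1) P.val 0 0 ≠ 0 :=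
      twistGram_eigenframe_apply_ne_zero (galAdicCompletionMap (L := L) (IsCMField.complexConj L) hw) (placeForm (Matrix.of fun i j : Fin 2 => if i.val + j.val + 1 = 2 then (1 : L) else 0) w.1) (by rw [det_placeForm_antidiagTwo]; norm_num) γ.2 hP hu hu1 0
    have hodd : Odd (WithZero.log (Valued.v (toPlace v w (HeckeCharacter.uniformizer ↥(maximalRealSubfield L) v : v.adicCompletion ↥(maximalRealSubfield L))))) := by
      rw [hϖv, WithZero.log_exp]; exact ⟨-1, by norm_num⟩
    rw [htw, hinv, even_log_inv_mul_iff_not_even hϖ0 hne hodd] at hpar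
    constructor
    · intro hev
      rcases Nat.le_one_iff_eq_zero_or_eq_one.1 he1 with h0 | h1
      · exact absurd h0 (fun h0 => (hpar.2 h0) hev)
      · exact h1
    · intro h1
      -- `e = 1` and `¬ Even ↔ e = 0` give `Even`
      by_contra hne'
      have h0 := hpar.1 hne'
      omega
  · rw [hes, Units.val_mul, Units.val_mul, hxm, Matrix.mul_smul, Matrix.smul_mul, Matrix.mul_one, ← Units.val_mul, mul_inv_cancel, Units.val_one]
  · intro i
    obtain ⟨hD1, hD2⟩ := coe_glDiagonal_one_eq (Units.mk0 (toPlace v w (HeckeCharacter.uniformizer ↥(maximalRealSubfield L) v : v.adicCompletion ↥(maximalRealSubfield L))) hϖ0)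
    rw [hes, Units.val_mul, Units.val_mul, hx i, hD1, hD2, Units.val_inv_eq_inv_val, Units.val_mk0]
    exact diagonal_mul_smul_one_add_mul_diagonal_inv _ hϖ0 (u 1) _ _
  · rw [finsum_fixedBy_quotient_mapConj_eq eϖ he (glInt 2 (w.1.adicCompletion L)) γ φ hφAd]
    simpa only [Function.comp_apply] using hsum

end Literature.NumberTheory.Automorphic.UnitaryGroup

end
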